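import Summits.Schanuel.Schanuel.Theorems.RootDecomp1DFlagSplit
import Summits.Schanuel.Schanuel.Theses.RootDecomp1J

/-!
# RootDecomp1J — ROUND 6 glue «coupling size» (lens 3, NODE v7): `G₂ → K₃ → K₂`

Proves the D-0019 glue item `SchanuelOverCurveClosedFieldsGlue` (stmt-Schanuel-30524) of the split of the round-5 residual
K₂ = `SchanuelOverCurveClosedFields` (stmt-Schanuel-29588) = `Rel(⊤|𝓚)` into G₂ = `PairBlocksOverCurveClosedFields`
(stmt-Schanuel-30522) = `Rel(𝓚₂|𝓚)` and K₃ = `SchanuelOverPairClosedFields` (stmt-Schanuel-30523, declared residual) = `Rel(⊤|𝓚₂)`,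
by ONE transit of relative-Schanuel transitivity (E1, `RootDecomp1DFlagSplit.relOn_trans`, landed) along `𝓚 ≤ 𝓚₂ ≤ ⊤`, where `𝓚` is
the route's curve hull of the EL-span and `𝓚₂ = blockHull 2 𝓚` its pair hull (level `0` of the `iSup` already contains `𝓚`).
Port of `HOME/decomp-schanuel-lens-3/v7/prover/RootDecomp1JPairSplit.port.lean` (= node `PeriodFlagSplit.pK2_of_splitG`) by the census
seat (prover role), in the style of `RootDecomp1DCurveSplit`: the engine is imported, not restated; the two `_local` copies are gone
(route constants since rev 1); this file defines nothing; 0 sorry.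
-/

set_option linter.dupNamespace false

noncomputable section

namespace Summit.Schanuel.Schanuel.Theorems.RootDecomp1JPairSplit

open Summit.Schanuel.Schanuel.Theses.RootDecomp1J
open Summit.Schanuel.Schanuel.Theorems.RootDecomp1DFlagSplit (relOn_trans)

/-- `𝓚 ≤ 𝓚₂`: the curve hull is level `0` of the pair hull `⨆ n, blockStep^[n+1] 𝓚` (and `𝓚 ≤ blockStep 𝓚`). -/
theorem curveSpan_le_pairSpan :
    (⨆ n : ℕ, (fun E : Submodule ℚ ℂ => E ⊔ Submodule.span ℚ {g : ℂ | ∃ Y : Finset ℂ, (↑Y : Set ℂ) ⊆ ↑E ∧ Algebra.trdeg ↥(IntermediateField.adjoin ℚ ((↑Y : Set ℂ) ∪ Complex.exp '' ↑Y)) ↥(IntermediateField.adjoin ↥(IntermediateField.adjoin ℚ ((↑Y : Set ℂ) ∪ Complex.exp '' ↑Y)) ({g, Complex.exp g} : Set ℂ)) ≤ 1})^[n + 1] (⨆ n : ℕ, (fun E : Submodule ℚ ℂ => (E ⊔ Submodule.span ℚ (Complex.exp '' ↑E)) ⊔ Submodule.span ℚ (Complex.exp ⁻¹' ↑(E ⊔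 Submodule.span ℚ (Complex.exp '' ↑E))))^[n + 1] (Submodule.span ℚ ({z : ℂ | IsAlgebraic ℚ z} ∪ {z : ℂ | ∃ β l : ℂ, IsAlgebraic ℚ β ∧ IsAlgebraic ℚ (Complex.exp l) ∧ z = β * l})))) ≤
      (⨆ n : ℕ, (fun E : Submodule ℚ ℂ => E ⊔ Submodule.span ℚ {x : ℂ | ∃ N : ℕ, N ≤ 2 ∧ ∃ w : Fin N → ℂ, (∃ Y : Finset ℂ, (↑Y : Set ℂ) ⊆ ↑E ∧ ∀ T : Finset ℂ, Y ⊆ T → ∀ (r : ℕ) (ρ : Fin r → Fin N), (∀ j, w j ∈ Submodule.span ℚ ((↑T : Set ℂ) ∪ Set.range (w ∘ ρ))) → Algebra.trdeg ↥(IntermediateField.adjoin ℚ ((↑T : Set ℂ) ∪ Complex.exp '' ↑T)) ↥(IntermediateField.adjoin ↥(IntermediateField.adjoin ℚ ((↑T : Set ℂ) ∪ Complex.exp '' ↑T)) (Set.range w ∪ Set.range (Complex.exp ∘ w))) ≤ r) ∧ x ∈ Set.range w})^[n + 1] (⨆ n : ℕ, (fun E : Submodule ℚ ℂ => E ⊔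 Submodule.span ℚ {g : ℂ | ∃ Y : Finset ℂ, (↑Y : Set ℂ) ⊆ ↑E ∧ Algebra.trdeg ↥(IntermediateField.adjoin ℚ ((↑Y : Set ℂ) ∪ Complex.exp '' ↑Y)) ↥(IntermediateField.adjoin ↥(IntermediateField.adjoin ℚ ((↑Y : Set ℂ) ∪ Complex.exp '' ↑Y)) ({g, Complex.exp g} : Set ℂ)) ≤ 1})^[n + 1] (⨆ n : ℕ, (fun E : Submodule ℚ ℂ => (E ⊔ Submodule.span ℚ (Complex.exp '' ↑E)) ⊔ Submodule.span ℚ (Complex.exp ⁻¹' ↑(E ⊔ Submodule.span ℚ (Complex.exp '' ↑E))))^[n + 1] (Submodule.span ℚ ({z : ℂ | IsAlgebraic ℚ z} ∪ {z : ℂ | ∃ β l : ℂ, IsAlgebraic ℚ β ∧ IsAlgebraic ℚ (Complex.exp l) ∧ z = β * l}))))) := by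
  refine le_trans ?_ (le_iSup_of_le 0 le_rfl)
  simp only [zero_add, Function.iterate_one]
  exact le_sup_left

/-- Item stmt-Schanuel-30524 (glue of the split of `SchanuelOverCurveClosedFields`): `G₂ → K₃ → K₂` by transitivity (E1) along
`𝓚 ≤ 𝓚₂ ≤ ⊤` (items over `⊤` omit the vacuous membership hypothesis). -/
theorem schanuelOverCurveClosedFieldsGlue_holds : SchanuelOverCurveClosedFieldsGlue := by
  intro hG2 hK3 k m y z hy hz
  exact relOn_trans (E'' := ⊤) curveSpan_le_pairSpan hG2
    (fun k m y z hy _ hz => hK3 k m y z hy hz) k m y z hy (fun _ => Submodule.mem_top) hz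

end Summit.Schanuel.Schanuel.Theorems.RootDecomp1JPairSplit
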